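import Summits.HubbardSuperconductivity.HubbardSuperconductivity.Theorems.AnisotropyChordTransferFibre3FinXDCheck

/-!
# Route `AnisotropyChord` / H0 rotor rung: FIN per-`L` row-D (KT-2a″) SUB-CELL facts, `L = 9` (90–95)

Row-D facts `xdCellAny0 9 (49/50) la lb aD = true` on quarter sub-cells of the combined cells whose side condition needs `aD ≈ .04` (mechhunt STATUS p3 g7 REPORT 3).
Prover seat `hubbard-h0-rotor-p3` g7; helper for piece A = stmt-HubbardSuperconductivity-23918 of rung 19089 (`--supports`, helper class).
WHAT THIS IS NOT: nothing here proves superconductivity in the Hubbard model (rotor TARGET as worded stays FALSE, g15 verdict); kernel facts /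
assembly for ONE conditional reduction at one `L`.  No sorry.
-/

set_option linter.dupNamespace false
set_option autoImplicit false

namespace Summit.HubbardSuperconductivity.HubbardSuperconductivity.Theorems.AnisotropyChord.Transfer.Fibre3

namespace FinXD

/-- row-D sub-cell `[18748405272171107, 18864136168912904]` of `L = 9`. [folklore] -/
theorem xd9s_133_2 : xdCellAny0 9 (49/50 : ℚ) 18748405272171107 18864136168912904 (1/25 : ℚ) = true := by decide +kernel

/-- row-D sub-cell `[18864136168912904, 18979867065654701]` of `L = 9`. [folklore] -/
theorem xd9s_133_3 : xdCellAny0 9 (49/50 : ℚ) 18864136168912904 18979867065654701 (1/25 : ℚ) = true := by decide +kernel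

/-- row-D sub-cell `[18979867065654701, 19098491234815042]` of `L = 9`. [folklore] -/
theorem xd9s_134_0 : xdCellAny0 9 (49/50 : ℚ) 18979867065654701 19098491234815042 (1/25 : ℚ) = true := by decide +kernel

/-- row-D sub-cell `[19098491234815042, 19217115403975383]` of `L = 9`. [folklore] -/
theorem xd9s_134_1 : xdCellAny0 9 (49/50 : ℚ) 19098491234815042 19217115403975383 (1/25 : ℚ) = true := by decide +kernel

/-- row-D sub-cell `[19217115403975383, 19335739573135724]` of `L = 9`. [folklore] -/
theorem xd9s_134_2 : xdCellAny0 9 (49/50 : ℚ) 19217115403975383 19335739573135724 (1/25 : ℚ) = true := by decide +kernel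

/-- row-D sub-cell `[19335739573135724, 19454363742296065]` of `L = 9`. [folklore] -/
theorem xd9s_134_3 : xdCellAny0 9 (49/50 : ℚ) 19335739573135724 19454363742296065 (1/25 : ℚ) = true := by decide +kernel

end FinXD

end Summit.HubbardSuperconductivity.HubbardSuperconductivity.Theorems.AnisotropyChord.Transfer.Fibre3
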